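import Summits.Ventures.Crystal3D.Theorems.StickyWulffConstantPolycrystalWulffBoundTwinSectionShiftSlabZones
import Summits.Ventures.Crystal3D.Theorems.StickyWulffConstantPolycrystalWulffBoundTwinSectionShiftHolds

/-!
# `PolycrystalWulffBound`, line `PolyDensity`: the slab-wise twin section shift in the crux's vocabulary
# — for a co-axial pair `Ax m A B`, a horizontal nearest-neighbour bond `u` of `A`'s lattice and the
# horizontal `w ⊥ u`, every height slab `{⟪y,m⟫ ∈ I}` satisfies
# `|W(B) ∩ slab ∩ {⟪y,ν⟫ < t}| ≤ |W(A) ∩ slab ∩ {⟪y,ν⟫ < t + (2/√6)|⟪w,ν⟫|}|` (crux `stmt-Ventures-19482`)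

Route `StickyWulffConstant` of the venture `Summits/Ventures/Crystal3D`, second prover lane (poly-p2,
gen 9).  Transport of `fccWulffBody_twin_slab_cdf_le₀/₁/₂` (`…TwinSectionShiftSlabZones.lean`) to the
crux's bodies `W(A)`, exactly as `…TwinSectionShiftHolds.lean` transports the unrestricted statement:
* `exists_frame_cruxWulffBody_lattice` — the self-clause of `Ax` gives a frame `M` with
  `W(A) = M '' W₁`, `A '' Λ₀ = M '' Λ₀` and `M e₂ = ±m`;
* `zone_of_horizontal_bond` — in the cubic frame a horizontal nearest-neighbour bond `u'`
  (`u' ∈ fccKissingPattern`, `u' ⊥ (1,1,1)`) and a unit `w' ⊥ u', (1,1,1)` satisfy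
  `(2/√6)|⟪w', ν⟫| = |⟪d_k, ν⟫|/3` for the zone vector `d_k ∥ w'`;
* **`cruxWulffBody_twin_slab_cdf_le`** — the statement of the title (`u ∈ A '' Λ₀`, `‖u‖ = 1`, `u ⊥ m`,
  `‖w‖ = 1`, `w ⊥ m`, `w ⊥ u`; `I` measurable; all `ν`, `t`).  With `u` a horizontal bond and
  `ν ⊥ w' ∈ ⟨110⟩`… i.e. for the walls of a `⟨110⟩`-zone texture (`|⟪w,ν⟫| ≤ ½·sin∠(ν,m)·…`) this is
  the slice-wise «SectionShift ≤ 1/√6» input of the m-first zone engine (memo P-TWIN-g9 §4(a)).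
WHAT THIS IS NOT: the zone-with-loss engine; any rung; the crux is not claimed. -/

noncomputable section

open scoped BigOperators InnerProductSpace ENNReal
open MeasureTheory Set

namespace Summit.Ventures.Crystal3D.Theorems

open Summit.Ventures.Crystal3D.Cruxes.TextureLiminf.TexShadow (E3)
open Literature.MathematicalPhysics.StatisticalMechanics (fccStacking barlowStacking IsHaggSeq
  fccWulffBody isCompact_fccWulffBody)
open Literature.Geometry.DiscreteGeometry (fccKissingPattern fccInt scaledPattern intVec intVec_apply)

/-! ### The frame of a co-axially embedded grain, with its lattice -/

/-- The self-clause of `Ax` pins the Wulff body AND the lattice to one frame: `W(A) = M '' W₁`,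
`A '' Λ₀ = M '' Λ₀`, `M e₂ = ±m`. -/
theorem exists_frame_cruxWulffBody_lattice {m : E3} {A : E3 ≃ₗᵢ[ℝ] E3}
    (h : ∃ (L : E3 ≃ₗᵢ[ℝ] E3) (s₁ s₂ : E3) (σ σ' : ℤ → ℤ), IsHaggSeq σ ∧ IsHaggSeq σ' ∧
      L (EuclideanSpace.single (2 : Fin 3) (1 : ℝ)) = m ∧
      A '' fccStacking 1 (Real.sqrt (2 / 3)) ⊆
        (fun q => L q + s₁) '' barlowStacking 1 (Real.sqrt (2 / 3)) σ ∧
      A '' fccStacking 1 (Real.sqrt (2 / 3)) ⊆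
        (fun q => L q + s₂) '' barlowStacking 1 (Real.sqrt (2 / 3)) σ') :
    ∃ M : E3 ≃ₗᵢ[ℝ] E3,
      {y : E3 | ∀ ν : E3, ⟪y, ν⟫_ℝ ≤ Real.sqrt 2 / 4 *
          ∑ᶠ w ∈ {w | w ∈ fccStacking 1 (Real.sqrt (2 / 3)) ∧ ‖w‖ = 1}, |⟪w, A.symm ν⟫_ℝ|} =
        M '' {y : E3 | ∀ ν : E3, ⟪y, ν⟫_ℝ ≤ Real.sqrt 2 / 4 *
          ∑ᶠ w ∈ {w | w ∈ fccStacking 1 (Real.sqrt (2 / 3)) ∧ ‖w‖ = 1},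
            |⟪w, (LinearIsometryEquiv.refl ℝ E3).symm ν⟫_ℝ|} ∧
      A '' fccStacking 1 (Real.sqrt (2 / 3)) = M '' fccStacking 1 (Real.sqrt (2 / 3)) ∧
      (M (EuclideanSpace.single (2 : Fin 3) 1) = m ∨ M (EuclideanSpace.single (2 : Fin 3) 1) = -m) := by
  obtain ⟨L, s₁, -, σ, -, hσ, -, hLm, h1, -⟩ := h
  have h1' : (fun p => A p + (0 : E3)) '' fccStacking 1 (Real.sqrt (2 / 3)) ⊆
      (fun q => L q + s₁) '' barlowStacking 1 (Real.sqrt (2 / 3)) σ := by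
    simpa only [add_zero] using h1
  obtain ⟨-, hAeq⟩ := linear_image_eq_frame_of_subset A L 0 s₁ hσ h1'
  set R := (ℝ ∙ EuclideanSpace.single (2 : Fin 3) (1 : ℝ))ᗮ.reflection with hR
  rcases hσ 0 with h0 | h0
  · rw [h0] at hAeq
    have hfcc : barlowStacking 1 (Real.sqrt (2 / 3)) (fun _ : ℤ => (1 : ℤ)) =
        fccStacking 1 (Real.sqrt (2 / 3)) := rfl
    rw [hfcc] at hAeq
    refine ⟨L, ?_, hAeq, Or.inl hLm⟩
    rw [wulffBody_eq_of_image_eq hAeq, cruxWulffBody_eq_image_self L]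
  · rw [h0, twinStacking_eq_image_basalMirror, ← Set.image_comp] at hAeq
    have hAeq' : A '' fccStacking 1 (Real.sqrt (2 / 3)) =
        (R.trans L) '' fccStacking 1 (Real.sqrt (2 / 3)) := by
      rw [hAeq, LinearIsometryEquiv.coe_trans]
    refine ⟨R.trans L, ?_, hAeq', Or.inr ?_⟩
    · rw [wulffBody_eq_of_image_eq hAeq', cruxWulffBody_eq_image_self (R.trans L)]
    · rw [LinearIsometryEquiv.coe_trans, Function.comp_apply, hR,
        Submodule.reflection_orthogonalComplement_singleton_eq_neg, map_neg, hLm]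

/-! ### The zone of a horizontal nearest-neighbour bond -/

/-- **The zone of a horizontal bond.**  In the cubic frame: if `u' ∈ fccKissingPattern` is horizontal
(`⟪u', (1,1,1)⟫ = 0`) and `w'` is a unit vector orthogonal to `u'` and to `(1,1,1)`, then `w'` is
parallel to one of the zone vectors `d_k` and `(2/√6)|⟪w', ν⟫| = |⟪d_k, ν⟫|/3` for all `ν`. -/
theorem zone_of_horizontal_bond {u' w' : E3} (hu' : u' ∈ (fccKissingPattern : Set E3))
    (hu'd : ⟪u', (!₂[(1 : ℝ), 1, 1] : E3)⟫_ℝ = 0) (hw' : ‖w'‖ = 1)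
    (hw'd : ⟪w', (!₂[(1 : ℝ), 1, 1] : E3)⟫_ℝ = 0) (hw'u : ⟪w', u'⟫_ℝ = 0) :
    (∀ ν : E3, 2 / Real.sqrt 6 * |⟪w', ν⟫_ℝ| = |⟪(!₂[(-2 : ℝ), 1, 1] : E3), ν⟫_ℝ| / 3) ∨
    (∀ ν : E3, 2 / Real.sqrt 6 * |⟪w', ν⟫_ℝ| = |⟪(!₂[(1 : ℝ), -2, 1] : E3), ν⟫_ℝ| / 3) ∨
    (∀ ν : E3, 2 / Real.sqrt 6 * |⟪w', ν⟫_ℝ| = |⟪(!₂[(1 : ℝ), 1, -2] : E3), ν⟫_ℝ| / 3) := by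
  rw [Finset.mem_coe, fccKissingPattern, scaledPattern, Finset.mem_image] at hu'
  obtain ⟨t, ht, rfl⟩ := hu'
  have h2 : (Real.sqrt ((2 : ℕ) : ℝ))⁻¹ ≠ 0 := by positivity
  -- the bond is horizontal: `t₀ + t₁ + t₂ = 0`
  have hsum : (t 0 : ℝ) + t 1 + t 2 = 0 := by
    rw [real_inner_smul_left, mul_eq_zero] at hu'd
    rcases hu'd with h | h
    · exact absurd h h2
    · rw [real_inner_comm, (inner_cubic_vectors _).1] at h
      simpa [intVec_apply] using h
  -- `w' ⊥ u'`: `t₀ w₀ + t₁ w₁ + t₂ w₂ = 0`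
  have hwt : (t 0 : ℝ) * w' 0 + t 1 * w' 1 + t 2 * w' 2 = 0 := by
    rw [real_inner_smul_right, mul_eq_zero] at hw'u
    rcases hw'u with h | h
    · exact absurd h h2
    · have : ⟪w', intVec t⟫_ℝ = w' 0 * t 0 + w' 1 * t 1 + w' 2 * t 2 := by
        simp [PiLp.inner_apply, Fin.sum_univ_three, intVec_apply, mul_comm]
      rw [this] at h
      linarith [h]
  -- `w' ⊥ (1,1,1)` and `‖w'‖ = 1`
  have hwd : w' 0 + w' 1 + w' 2 = 0 := by
    rw [real_inner_comm, (inner_cubic_vectors _).1] at hw'd; exact hw'd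
  have hwn : w' 0 ^ 2 + w' 1 ^ 2 + w' 2 ^ 2 = 1 := by
    have h := hw'
    rw [EuclideanSpace.norm_eq, Real.sqrt_eq_one, Fin.sum_univ_three] at h
    simpa only [Real.norm_eq_abs, sq_abs] using h
  have h6 : Real.sqrt 6 ^ 2 = 6 := Real.sq_sqrt (by norm_num)
  have h6pos : 0 < Real.sqrt 6 := Real.sqrt_pos.2 (by norm_num)
  -- the common computation: if `w' = c • d_k` coordinatewise then the identity holds
  have key : ∀ (dk : E3) (c : ℝ), 6 * c ^ 2 = 1 → (∀ ν : E3, ⟪w', ν⟫_ℝ = c * ⟪dk, ν⟫_ℝ) →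
      ∀ ν : E3, 2 / Real.sqrt 6 * |⟪w', ν⟫_ℝ| = |⟪dk, ν⟫_ℝ| / 3 := by
    intro dk c hc hν ν
    rw [hν ν, abs_mul]
    have hca : |c| = 1 / Real.sqrt 6 := by
      rw [← Real.sqrt_sq (abs_nonneg c), sq_abs, show c ^ 2 = 1 / 6 by linarith, Real.sqrt_div' ,
        Real.sqrt_one]
      norm_num
    rw [hca]
    field_simp
    rw [h6]
    ring
  have hin0 : ∀ ν : E3, ⟪(!₂[(-2 : ℝ), 1, 1] : E3), ν⟫_ℝ = -2 * ν 0 + ν 1 + ν 2 :=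
    fun ν => (inner_cubic_vectors ν).2.2.2
  have hin1 : ∀ ν : E3, ⟪(!₂[(1 : ℝ), -2, 1] : E3), ν⟫_ℝ = ν 0 - 2 * ν 1 + ν 2 :=
    fun ν => (inner_cubic_vectors ν).2.2.1
  have hin2 : ∀ ν : E3, ⟪(!₂[(1 : ℝ), 1, -2] : E3), ν⟫_ℝ = ν 0 + ν 1 - 2 * ν 2 :=
    fun ν => (inner_cubic_vectors ν).2.1
  have hwν : ∀ ν : E3, ⟪w', ν⟫_ℝ = w' 0 * ν 0 + w' 1 * ν 1 + w' 2 * ν 2 := by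
    intro ν; simp [PiLp.inner_apply, Fin.sum_univ_three, mul_comm]
  simp only [fccInt, Finset.mem_insert, Finset.mem_singleton] at ht
  rcases ht with rfl | rfl | rfl | rfl | rfl | rfl | rfl | rfl | rfl | rfl | rfl | rfl <;>
    simp only [Matrix.cons_val_zero, Matrix.cons_val_one, Matrix.head_cons, Matrix.cons_val_two,
      Matrix.tail_cons, Int.cast_one, Int.cast_neg, Int.cast_zero] at hsum hwt
  · norm_num at hsum
  · -- t = (1,-1,0): zone 2
    have h01 : w' 1 = w' 0 := by linarith
    have h2' : w' 2 = -2 * w' 0 := by linarith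
    refine Or.inr (Or.inr (key _ (w' 0) ?_ fun ν => ?_))
    · rw [h01, h2'] at hwn; linear_combination hwn
    · rw [hwν, hin2, h01, h2']; ring
  · -- t = (-1,1,0): zone 2
    have h01 : w' 1 = w' 0 := by linarith
    have h2' : w' 2 = -2 * w' 0 := by linarith
    refine Or.inr (Or.inr (key _ (w' 0) ?_ fun ν => ?_))
    · rw [h01, h2'] at hwn; linear_combination hwn
    · rw [hwν, hin2, h01, h2']; ring
  · norm_num at hsum
  · norm_num at hsum
  · -- t = (1,0,-1): zone 1
    have h02 : w' 2 = w' 0 := by linarith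
    have h1' : w' 1 = -2 * w' 0 := by linarith
    refine Or.inr (Or.inl (key _ (w' 0) ?_ fun ν => ?_))
    · rw [h02, h1'] at hwn; linear_combination hwn
    · rw [hwν, hin1, h02, h1']; ring
  · -- t = (-1,0,1): zone 1
    have h02 : w' 2 = w' 0 := by linarith
    have h1' : w' 1 = -2 * w' 0 := by linarith
    refine Or.inr (Or.inl (key _ (w' 0) ?_ fun ν => ?_))
    · rw [h02, h1'] at hwn; linear_combination hwn
    · rw [hwν, hin1, h02, h1']; ring
  · norm_num at hsum
  · norm_num at hsum
  · -- t = (0,1,-1): zone 0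
    have h12 : w' 2 = w' 1 := by linarith
    have h0' : w' 0 = -2 * w' 1 := by linarith
    refine Or.inl (key _ (w' 1) ?_ fun ν => ?_)
    · rw [h12, h0'] at hwn; linear_combination hwn
    · rw [hwν, hin0, h12, h0']; ring
  · -- t = (0,-1,1): zone 0
    have h12 : w' 2 = w' 1 := by linarith
    have h0' : w' 0 = -2 * w' 1 := by linarith
    refine Or.inl (key _ (w' 1) ?_ fun ν => ?_)
    · rw [h12, h0'] at hwn; linear_combination hwn
    · rw [hwν, hin0, h12, h0']; ring
  · norm_num at hsum

/-! ### The slab-wise shift in the crux's vocabulary -/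

/-- **Slab-wise twin section shift of the crux's Wulff bodies.**  For a co-axial frame pair
(`Ax m A B`), a horizontal nearest-neighbour bond `u` of `A`'s lattice (`u ∈ A '' Λ₀`, `‖u‖ = 1`,
`u ⊥ m`), a unit `w ⊥ m, u` (a horizontal `⟨112⟩` direction of `A`'s lattice), every measurable set `I`
of heights, every `ν` and `t`:
`|W(B) ∩ {⟪y,m⟫ ∈ I} ∩ {⟪y,ν⟫ < t}| ≤ |W(A) ∩ {⟪y,m⟫ ∈ I} ∩ {⟪y,ν⟫ < t + (2/√6)|⟪w,ν⟫|}|`. -/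
theorem cruxWulffBody_twin_slab_cdf_le {m : E3} {A B : E3 ≃ₗᵢ[ℝ] E3}
    (hAx : ∃ (L : E3 ≃ₗᵢ[ℝ] E3) (s₁ s₂ : E3) (σ σ' : ℤ → ℤ), IsHaggSeq σ ∧ IsHaggSeq σ' ∧
      L (EuclideanSpace.single (2 : Fin 3) (1 : ℝ)) = m ∧
      A '' fccStacking 1 (Real.sqrt (2 / 3)) ⊆
        (fun q => L q + s₁) '' barlowStacking 1 (Real.sqrt (2 / 3)) σ ∧
      B '' fccStacking 1 (Real.sqrt (2 / 3)) ⊆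
        (fun q => L q + s₂) '' barlowStacking 1 (Real.sqrt (2 / 3)) σ')
    {u w : E3} (hu : u ∈ A '' fccStacking 1 (Real.sqrt (2 / 3))) (hu1 : ‖u‖ = 1) (hum : ⟪u, m⟫_ℝ = 0)
    (hw : ‖w‖ = 1) (hwm : ⟪w, m⟫_ℝ = 0) (hwu : ⟪w, u⟫_ℝ = 0)
    {I : Set ℝ} (hI : MeasurableSet I) (ν : E3) (t : ℝ) :
    volume ({y : E3 | ∀ ν : E3, ⟪y, ν⟫_ℝ ≤ Real.sqrt 2 / 4 *
        ∑ᶠ w ∈ {w | w ∈ fccStacking 1 (Real.sqrt (2 / 3)) ∧ ‖w‖ = 1}, |⟪w, B.symm ν⟫_ℝ|} ∩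
        {y : E3 | ⟪y, m⟫_ℝ ∈ I} ∩ {y : E3 | ⟪y, ν⟫_ℝ < t}) ≤
      volume ({y : E3 | ∀ ν : E3, ⟪y, ν⟫_ℝ ≤ Real.sqrt 2 / 4 *
        ∑ᶠ w ∈ {w | w ∈ fccStacking 1 (Real.sqrt (2 / 3)) ∧ ‖w‖ = 1}, |⟪w, A.symm ν⟫_ℝ|} ∩
        {y : E3 | ⟪y, m⟫_ℝ ∈ I} ∩ {y : E3 | ⟪y, ν⟫_ℝ < t + 2 / Real.sqrt 6 * |⟪w, ν⟫_ℝ|}) := by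
  have hδ0 : 0 ≤ 2 / Real.sqrt 6 * |⟪w, ν⟫_ℝ| := by positivity
  rcases cruxWulffBody_eq_or_eq_reflection_image hAx with hB | hB
  · rw [hB]
    exact measure_mono (inter_subset_inter_right _ fun y hy => lt_of_lt_of_le hy
      (le_add_of_nonneg_right hδ0))
  rw [hB]
  -- frames
  obtain ⟨L', s₁, -, σ, -, hσ, -, hL'm, h1, -⟩ := hAx
  have hm : ‖m‖ = 1 := by rw [← hL'm, LinearIsometryEquiv.norm_map, PiLp.norm_single, norm_one]
  obtain ⟨M, hWA, hAΛ, hMm⟩ := exists_frame_cruxWulffBody_lattice (m := m) (A := A)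
    ⟨L', s₁, s₁, σ, σ, hσ, hσ, hL'm, h1, h1⟩
  obtain ⟨L, hL, c, hLc⟩ := exists_cubicFrame_unitShell_eq
  have hW1 := cruxWulffBody_eq_image_fccWulffBody hL (LinearIsometryEquiv.refl ℝ E3)
  rw [LinearIsometryEquiv.trans_refl] at hW1
  rw [hW1, ← image_comp] at hWA
  set T : E3 ≃ₗᵢ[ℝ] E3 := L.trans M with hT
  have hWA' : {y : E3 | ∀ ν : E3, ⟪y, ν⟫_ℝ ≤ Real.sqrt 2 / 4 *
      ∑ᶠ w ∈ {w | w ∈ fccStacking 1 (Real.sqrt (2 / 3)) ∧ ‖w‖ = 1}, |⟪w, A.symm ν⟫_ℝ|} =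
      T '' fccWulffBody := by
    rw [hWA, hT, LinearIsometryEquiv.coe_trans]
  set d : E3 := !₂[(1 : ℝ), 1, 1] with hd
  obtain ⟨ε, hε, hTd⟩ : ∃ ε : ℝ, (ε = 1 ∨ ε = -1) ∧ T d = (ε * c) • m := by
    rcases hMm with h | h
    · exact ⟨1, Or.inl rfl, by rw [hT, LinearIsometryEquiv.coe_trans, Function.comp_apply, hLc,
        LinearIsometryEquiv.map_smul, h, one_mul]⟩
    · exact ⟨-1, Or.inr rfl, by rw [hT, LinearIsometryEquiv.coe_trans, Function.comp_apply, hLc,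
        LinearIsometryEquiv.map_smul, h, smul_neg, ← neg_smul, neg_one_mul]⟩
  have hd3 : ‖d‖ ^ 2 = 3 := norm_sq_cubic_vectors.1
  have hεc2 : (ε * c) ^ 2 = 3 := by
    have h1 : ‖T d‖ = ‖d‖ := LinearIsometryEquiv.norm_map T d
    rw [hTd, norm_smul, hm, mul_one, Real.norm_eq_abs] at h1
    rw [← sq_abs, h1, hd3]
  have hεc : ε * c ≠ 0 := by
    intro h; rw [h] at hεc2; norm_num at hεc2
  -- the twin mirror and the slab in the cubic frame
  have hR : ⇑((ℝ ∙ m)ᗮ.reflection) = ⇑((ℝ ∙ T d)ᗮ.reflection) := by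
    funext x
    rw [hTd, reflection_orthogonal_smul_apply hεc]
  have hTm : ∀ x : E3, ⟪T x, m⟫_ℝ = (ε * c)⁻¹ * ⟪x, d⟫_ℝ := by
    intro x
    have h1 : ⟪T x, T d⟫_ℝ = ⟪x, d⟫_ℝ := LinearIsometryEquiv.inner_map_map T x d
    rw [hTd, real_inner_smul_right] at h1
    rw [← h1, ← mul_assoc, inv_mul_cancel₀ hεc, one_mul]
  set J : Set ℝ := (fun r : ℝ => (ε * c)⁻¹ * r) ⁻¹' I with hJ
  have hJm : MeasurableSet J := hI.preimage (measurable_const_mul _)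
  have hslab : ∀ S : Set E3, T '' S ∩ {y : E3 | ⟪y, m⟫_ℝ ∈ I} = T '' (S ∩ {x : E3 | ⟪x, d⟫_ℝ ∈ J}) := by
    intro S
    ext y
    constructor
    · rintro ⟨⟨x, hx, rfl⟩, hy⟩
      refine ⟨x, ⟨hx, ?_⟩, rfl⟩
      have h : ⟪T x, m⟫_ℝ ∈ I := hy
      rw [hTm] at h
      exact h
    · rintro ⟨x, ⟨hx, hxJ⟩, rfl⟩
      refine ⟨⟨x, hx, rfl⟩, ?_⟩
      show ⟪T x, m⟫_ℝ ∈ I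
      rw [hTm]
      exact hxJ
  rw [hWA', hR, reflection_image_image_eq_of_map T d fccWulffBody, hslab, hslab]
  have hWm : MeasurableSet (fccWulffBody : Set E3) := isCompact_fccWulffBody.measurableSet
  have hRW : MeasurableSet ((ℝ ∙ d)ᗮ.reflection '' (fccWulffBody : Set E3)) :=
    (isCompact_fccWulffBody.image (ℝ ∙ d)ᗮ.reflection.continuous).measurableSet
  have hZm : MeasurableSet {x : E3 | ⟪x, d⟫_ℝ ∈ J} :=
    hJm.preimage (continuous_id.inner continuous_const).measurable
  rw [volume_image_inter_halfSpace T (hRW.inter hZm) ν t, volume_image_inter_halfSpace T (hWm.inter hZm) ν]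
  -- the zone of `u`
  have hu' : T.symm u ∈ (fccKissingPattern : Set E3) := by
    rw [hAΛ] at hu
    obtain ⟨p, hp, rfl⟩ := hu
    have hp1 : ‖p‖ = 1 := by rw [← hu1, LinearIsometryEquiv.norm_map]
    have hpshell : p ∈ {w : E3 | w ∈ fccStacking 1 (Real.sqrt (2 / 3)) ∧ ‖w‖ = 1} := ⟨hp, hp1⟩
    rw [hL] at hpshell
    obtain ⟨q, hq, rfl⟩ := hpshell
    have : T.symm (M (L q)) = q := by
      rw [hT]
      show (L.trans M).symm ((L.trans M) q) = q
      exact (L.trans M).symm_apply_apply q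
    rw [this]
    exact hq
  have hinner : ∀ x y : E3, ⟪T.symm x, T.symm y⟫_ℝ = ⟪x, y⟫_ℝ := fun x y =>
    LinearIsometryEquiv.inner_map_map T.symm x y
  have hsd : ∀ x : E3, ⟪T.symm x, d⟫_ℝ = (ε * c) * ⟪x, m⟫_ℝ := by
    intro x
    rw [← T.inner_map_map (T.symm x) d, T.apply_symm_apply, hTd, real_inner_smul_right]
  have hu'd : ⟪T.symm u, d⟫_ℝ = 0 := by rw [hsd, hum, mul_zero]
  have hw' : ‖T.symm w‖ = 1 := by rw [LinearIsometryEquiv.norm_map, hw]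
  have hw'd : ⟪T.symm w, d⟫_ℝ = 0 := by rw [hsd, hwm, mul_zero]
  have hw'u : ⟪T.symm w, T.symm u⟫_ℝ = 0 := by rw [hinner, hwu]
  have hwν : ⟪T.symm w, T.symm ν⟫_ℝ = ⟪w, ν⟫_ℝ := hinner w ν
  rcases zone_of_horizontal_bond hu' hu'd hw' hw'd hw'u with hz | hz | hz
  · rw [← hwν, hz]; exact fccWulffBody_twin_slab_cdf_le₀ hJm (T.symm ν) t
  · rw [← hwν, hz]; exact fccWulffBody_twin_slab_cdf_le₁ hJm (T.symm ν) t
  · rw [← hwν, hz]; exact fccWulffBody_twin_slab_cdf_le₂ hJm (T.symm ν) t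

end Summit.Ventures.Crystal3D.Theorems

end
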